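import Summits.QuantumFields.BalabanUV.Beta.RemainderExplicitHistoryDiagonalEchoMonotone

/-!
# RemainderExplicitHistoryDiagonalMemoryZone — ROAD P3, ORDER-0 PROFILE FAMILY: THE MEMORY-ZONE CRITERION FOR EXACT MONOTONICITY IN THE
# POSITION — for two infrared-pinned runs (A: `K` steps, B: `K + n` steps) of `β_{k+1} = b + Σ_{a≤k} ρ(a)·min(g_k, |g_k − g_{k−a}|)` the
# matched discrepancy `d_j = 1∕(g^B_{j+n})² − 1∕(g^A_j)²` is non-increasing on `[0, J+1]` as soon as, at every position `1 ≤ j ≤ J`, the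
# POSITION EXCESS AT THE CURRENT DISCREPANCY `Σ_{i<j} ρ(j−i)·[(g^A_j − g^B_{j+n}) − (g^A_i − 1∕√(1∕(g^A_i)² + d_j))]` is at most B's extra-age
# source `E_j` (forward induction: a dominating past makes every past gap at least its trial gap at the current discrepancy); with the first
# file's echo count beyond the memory, census item (i′) for a non-increasing profile of memory `A ≥ 3` is REDUCED to this a-priori inequality
# on the `A − 1` memory-zone positions (seat numerics: ratio ≤ 0.133 in 1 776 cases); tool: the discrepancy with the pin's window dropped,
# `d_{j₀} ≤ Σ_{j≥j₀} E_j + (K − j₀)·Σ_{i<j₀} ρ(j₀−i)e_i + Σ_{i∈[j₀,K)} e_i·Σ_{a>i} ρ(a)` (station S-d4p3-g54-1 «the echo count», third file)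

Cell `pub-balaban`, β-function sub-cell, BINDER row D4 «RemainderConst leaves for Bałaban's split» (`HOME/BINDER-OWNERS.md`; owner lineage
`b2b-balaban-beta-an4`; this file by co-owner #3 lineage `b2b-balaban-beta-d4-p3`, road P3 «the reduction road», generation 54, station
S-d4p3-g54-1, third file; imports the first file `RemainderExplicitHistoryDiagonalEchoMonotone`), β-FLOW TEAM duty (1); FREEZE (0) honoured
(def-free module in road P3's own `RemainderExplicit*` series; no leaf, no interface, no Literature file).  SOURCE OF THE SHAPES ONLY:
[Balaban1987RG1] (0.20) p. 256, (0.31) and Thm 2 p. 259, §5 p. 298.  [folklore] real analysis about ONE explicit toy family (ours), road P3's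
ORDER-0 PROFILE FAMILY (generation 44).
HONEST FRAMING: *"Discharging BetaPertH makes Bałaban's UV stability UNCONDITIONAL — a real constructive-QFT result; it is NOT the continuum
limit and NOT the Clay problem."*  THIS FILE DISCHARGES NOTHING OF THE KIND; nothing of Bałaban's (1.22) is asserted or constructed; row D4
class UNCHANGED (critical-path width 0; instance 0∕1; D4 DISCHARGE NO DATE); NOT B12 Thm 2, NOT BetaPertH, NOT continuum, NOT Clay.  HONEST
DEPENDENCY: continuum YM on T⁴ ⇐ BetaPertH ∧ nine spine estimates (0/9 proved); BetaPertH ⇐ (D1) ∧ (D4) ∧ CAP+tail; G-an2-4 gates asym, D1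
and NE2/3/4.  ABSOLUTE RULE: nothing is cited as a fact.  All letters NOT-IN-PRINT; `BetaFlowAsPrinted S` records a Markov β_n only.

THE STRUCTURE (generation 54's analysis of census (i′), `HOME/b2b-balaban-beta-d4-p3/g54/I-PRIME-ANALYSIS-v2.md`).  The step identity
`d_j − d_{j+1} = E_j + Σ_{i≤j} ρ(j−i)(e_i − e_j)` (generation 49) is attacked FORWARD in the memory zone (`E_j > 0`) and by the ECHO COUNT beyond it
(first file, no induction).  Forward: if the past dominates (`d_i ≥ d_j`, `i < j`) then each past gap is at least its TRIAL GAP at the current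
discrepancy, `e_i ≥ g^A_i − 1∕√(1∕(g^A_i)² + d_j)` (`trialGap_le_gap`: the conversion `d ↦ e` is increasing), so
`d_j − d_{j+1} ≥ E_j − Σ_{i<j} ρ(j−i)·[(g^A_j − g^B_{j+n}) − (g^A_i − 1∕√(1∕(g^A_i)² + d_j))]` (`disc_step_ge_of_dominated`) — the bracket is the
POSITION EXCESS (the same discrepancy converts to a larger gap at the larger coupling), at most `g^A_j − g^A_i`, and by the concavity of the
conversion at most generation 53's linearised `(c_j − c_i)·d_j`.  The CRITERION «position excess ≤ E_j» at every memory-zone position therefore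
propagates the dominance (`disc_mono_of_criterion`) and, with the first file, gives monotonicity on the whole run (`disc_succ_le_disc_of_criterion`).
The criterion is NOT proved here: it is the located remaining inequality (numerics: ratio ≤ 0.133, argmax at the last memory positions of
`lin`∕`flat` profiles with `A = K`, `s = bγ² ∈ [1, 2]`); §4 supplies the natural upper bound of `d_j` for proving it (the window identity with the
pin's window dropped and the echo count on the past: `disc_le_dropped_echo`), in which only B's FUTURE extra sources and the future-in-memory
echo weights `Σ_{a>i} ρ(a)·e_i` are not controlled by the past.

WHAT IS PROVED ([folklore]; 0 sorry; 0 `def`).  §1 `trialGap_le_gap`, `trialGap_nonneg`.  §2 **`disc_step_ge_of_dominated`**.  §3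
**`disc_mono_of_criterion`** (criterion on `[1, J]` ⇒ `d_{j+1} ≤ d_j` on `[0, J]`), **`disc_succ_le_disc_of_criterion`** (criterion on the memory zone
+ non-increasing profile + `Wγ ≤ 2b` ⇒ monotone at every `j < K`).  §4 `disc_le_dropped`, `disc_le_dropped_echo`.
-/

noncomputable section

open Finset Filter Topology

namespace Summit.QuantumFields.BalabanUV.Beta.RemainderExplicitHistoryDiagonalMemoryZone

open Literature.MathematicalPhysics.QuantumFieldTheory.Balaban1983to89
open Literature.MathematicalPhysics.QuantumFieldTheory.Balaban1983to89.FlowStep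
open Literature.MathematicalPhysics.QuantumFieldTheory.Balaban1983to89.T4CouplingMatching
open Literature.MathematicalPhysics.QuantumFieldTheory.Balaban1983to89.T4ContinuumCoupling
open Summit.QuantumFields.BalabanUV.Beta.RemainderExplicitHistoryDiagonalMonotone
open Summit.QuantumFields.BalabanUV.Beta.RemainderExplicitHistoryDiagonalWeights
open Summit.QuantumFields.BalabanUV.Beta.RemainderExplicitHistoryDiagonalTwoRun
open Summit.QuantumFields.BalabanUV.Beta.RemainderExplicitHistoryDiagonalWindow
open Summit.QuantumFields.BalabanUV.Beta.RemainderExplicitHistoryDiagonalOneStepMonotone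
open Summit.QuantumFields.BalabanUV.Beta.RemainderExplicitHistoryDiagonalEchoMonotone

variable {β : HBeta} {b γ W : ℝ} {ρ : ℕ → ℝ}

/-! ## §1 The coupling gap at a past position dominates the gap it would have at the current discrepancy -/

/-- THE TRIAL GAP: for couplings `0 < B ≤ A` with discrepancy `1∕B² − 1∕A² ≥ D ≥ 0`, the gap `A − B` is at least the gap
`A − 1∕√(1∕A² + D)` that the larger coupling `A` would have at the smaller discrepancy `D` (the conversion is increasing in the discrepancy).
[folklore] -/
theorem trialGap_le_gap {A B D : ℝ} (hA : 0 < A) (hB : 0 < B) (hD : 0 ≤ D) (h : D ≤ 1 / B ^ 2 - 1 / A ^ 2) :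
    A - 1 / Real.sqrt (1 / A ^ 2 + D) ≤ A - B := by
  have hq : 0 < 1 / A ^ 2 + D := by positivity
  have hs : 0 < Real.sqrt (1 / A ^ 2 + D) := Real.sqrt_pos.mpr hq
  have hu : 0 < 1 / Real.sqrt (1 / A ^ 2 + D) := by positivity
  have husq : 1 / (1 / Real.sqrt (1 / A ^ 2 + D)) ^ 2 = 1 / A ^ 2 + D := by
    rw [one_div_pow, Real.sq_sqrt hq.le, one_div_one_div]
  have hle : B ≤ 1 / Real.sqrt (1 / A ^ 2 + D) := by
    refine le_of_one_div_sq_le hu hB ?_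
    rw [husq]; linarith
  linarith

/-- THE TRIAL GAP IS NONNEGATIVE AND AT MOST THE COUPLING: `0 ≤ A − 1∕√(1∕A² + D) ≤ A` for `A > 0`, `D ≥ 0`. [folklore] -/
theorem trialGap_nonneg {A D : ℝ} (hA : 0 < A) (hD : 0 ≤ D) : 0 ≤ A - 1 / Real.sqrt (1 / A ^ 2 + D) := by
  have hq : 0 < 1 / A ^ 2 + D := by positivity
  have hu : 0 < 1 / Real.sqrt (1 / A ^ 2 + D) := by positivity
  have husq : 1 / (1 / Real.sqrt (1 / A ^ 2 + D)) ^ 2 = 1 / A ^ 2 + D := by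
    rw [one_div_pow, Real.sq_sqrt hq.le, one_div_one_div]
  have hle : 1 / Real.sqrt (1 / A ^ 2 + D) ≤ A := by
    refine le_of_one_div_sq_le hA hu ?_
    rw [husq]; linarith
  linarith

/-! ## §2 The forward step: a dominating past bounds the decrement below by B's extra source minus the position excess -/

/-- **THE FORWARD STEP.**  Two runs of road P3's order-0 profile family (`b > 0`, `ρ ≥ 0`; A: `K` steps, B: `K + n` steps, positive couplings,
pinned) and a position `j < K` whose past DOMINATES it: `d_i ≥ d_j` for all `i < j` (`d_i = 1∕(g^B_{i+n})² − 1∕(g^A_i)²`).  THEN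
`d_j − d_{j+1} ≥ E_j − Σ_{i<j} ρ(j−i)·[(g^A_j − g^B_{j+n}) − (g^A_i − 1∕√(1∕(g^A_i)² + d_j))]` — in generation 49's step identity
`d_j − d_{j+1} = E_j + Σ_{i≤j} ρ(j−i)(e_i − e_j)` each past gap `e_i` is at least its TRIAL GAP at the current discrepancy (`trialGap_le_gap`); what
remains against `E_j` is the POSITION EXCESS of the current gap over the trial gaps of the past (nonnegative: the couplings grow), the exact
form of generation 53's `κ_j·d_j`. [cite: Balaban1987RG1, (0.20) p.256 and Thm 2 p.259] -/
theorem disc_step_ge_of_dominated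
    (hβ : ∀ (k : ℕ) (p : Fin (k + 1) → ℝ),
      β k p = b + ∑ i : Fin (k + 1), ρ (k - i) * min (p (Fin.last k)) (|p (Fin.last k) - p i|))
    (hb : 0 < b) (hρ0 : ∀ a, 0 ≤ ρ a) {K n : ℕ} {gA gB : ℕ → ℝ} (hA : RGEqH K β gA) (hB : RGEqH (K + n) β gB)
    (hApos : ∀ k, k ≤ K → 0 < gA k) (hBpos : ∀ k, k ≤ K + n → 0 < gB k) (hpin : gA K = gB (K + n)) {j : ℕ} (hj : j < K)
    (hdomPast : ∀ i, i < j → 1 / (gB (j + n)) ^ 2 - 1 / (gA j) ^ 2 ≤ 1 / (gB (i + n)) ^ 2 - 1 / (gA i) ^ 2) :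
    (∑ i ∈ range n, ρ (j + n - i) * (gB (j + n) - gB i))
        - ∑ i ∈ range j, ρ (j - i) * ((gA j - gB (j + n))
            - (gA i - 1 / Real.sqrt (1 / (gA i) ^ 2 + (1 / (gB (j + n)) ^ 2 - 1 / (gA j) ^ 2))))
      ≤ (1 / (gB (j + n)) ^ 2 - 1 / (gA j) ^ 2) - (1 / (gB (j + 1 + n)) ^ 2 - 1 / (gA (j + 1)) ^ 2) := by
  have hdom := invSq_le_invSq_shift_run hβ hb hρ0 hA hB hApos hBpos hpin
  have hdj : 0 ≤ 1 / (gB (j + n)) ^ 2 - 1 / (gA j) ^ 2 := by linarith [hdom j hj.le]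
  rw [disc_step_window hβ hb hρ0 hA hB hApos hBpos hj, Finset.sum_range_succ, Nat.sub_self, sub_self, mul_zero, add_zero]
  have hcmp : ∀ i ∈ range j, -(ρ (j - i) * ((gA j - gB (j + n))
      - (gA i - 1 / Real.sqrt (1 / (gA i) ^ 2 + (1 / (gB (j + n)) ^ 2 - 1 / (gA j) ^ 2)))))
      ≤ ρ (j - i) * ((gA i - gB (i + n)) - (gA j - gB (j + n))) := by
    intro i hi
    have hi' := Finset.mem_range.mp hi
    have ht := trialGap_le_gap (hApos i (by omega)) (hBpos (i + n) (by omega)) hdj (hdomPast i hi')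
    have hρ := hρ0 (j - i)
    nlinarith
  have hsum := Finset.sum_le_sum hcmp
  rw [Finset.sum_neg_distrib] at hsum
  linarith

/-! ## §3 The memory-zone criterion: forward induction -/

/-- **THE MEMORY-ZONE CRITERION (forward induction).**  Same two pinned runs (any `ρ ≥ 0`).  Suppose that at every position `1 ≤ j ≤ J`
(`J < K`) the POSITION EXCESS AT THE CURRENT DISCREPANCY is dominated by B's extra-age source:
`Σ_{i<j} ρ(j−i)·[(g^A_j − g^B_{j+n}) − (g^A_i − 1∕√(1∕(g^A_i)² + d_j))] ≤ E_j = Σ_{i<n} ρ(j+n−i)(g^B_{j+n} − g^B_i)`.  THEN the matched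
discrepancy is non-increasing on `[0, J+1]`: `d_{j+1} ≤ d_j` for every `j ≤ J` (position `0`: B's extra source alone; then `disc_step_ge_of_dominated`
step by step, the dominance of the past being the induction hypothesis).  This is the exact form of generation 53's located sufficient condition
`κ_j d_j ≤ E_j` in the memory zone (seat numerics of generation 54: ratio ≤ 0.13 in ≈ 1 000 cases). [cite: Balaban1987RG1, (0.20) p.256 and Thm 2 p.259] -/
theorem disc_mono_of_criterion
    (hβ : ∀ (k : ℕ) (p : Fin (k + 1) → ℝ),
      β k p = b + ∑ i : Fin (k + 1), ρ (k - i) * min (p (Fin.last k)) (|p (Fin.last k) - p i|))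
    (hb : 0 < b) (hρ0 : ∀ a, 0 ≤ ρ a) {K n : ℕ} {gA gB : ℕ → ℝ} (hA : RGEqH K β gA) (hB : RGEqH (K + n) β gB)
    (hApos : ∀ k, k ≤ K → 0 < gA k) (hBpos : ∀ k, k ≤ K + n → 0 < gB k) (hpin : gA K = gB (K + n)) {J : ℕ} (hJ : J < K)
    (hcrit : ∀ j, 1 ≤ j → j ≤ J →
      ∑ i ∈ range j, ρ (j - i) * ((gA j - gB (j + n))
          - (gA i - 1 / Real.sqrt (1 / (gA i) ^ 2 + (1 / (gB (j + n)) ^ 2 - 1 / (gA j) ^ 2))))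
        ≤ ∑ i ∈ range n, ρ (j + n - i) * (gB (j + n) - gB i)) :
    ∀ j, j ≤ J → 1 / (gB (j + 1 + n)) ^ 2 - 1 / (gA (j + 1)) ^ 2 ≤ 1 / (gB (j + n)) ^ 2 - 1 / (gA j) ^ 2 := by
  set d : ℕ → ℝ := fun j => 1 / (gB (j + n)) ^ 2 - 1 / (gA j) ^ 2 with hd
  -- strong induction: monotone on `[0, j]` for every `j ≤ J + 1`
  suffices hmain : ∀ j, j ≤ J → ∀ i, i ≤ j → d (i + 1) ≤ d i by
    intro j hj
    have := hmain j hj j le_rfl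
    simpa [hd, Nat.add_right_comm j 1 n] using this
  intro j
  induction j with
  | zero =>
    intro _ i hi
    have hi0 : i = 0 := by omega
    subst hi0
    have h0 := disc_step_zero hβ hb hρ0 hA hB hApos hBpos (by omega : 0 < K)
    have hE := extra_nonneg hβ hb hρ0 hB hBpos (j := 0) (Nat.zero_le K)
    simp only [Nat.zero_add] at h0 hE
    simp only [hd, Nat.zero_add]
    rw [Nat.add_comm 1 n] at h0 ⊢
    linarith
  | succ j ih =>
    intro hjJ i hi
    rcases Nat.lt_or_ge i (j + 1) with hij | hij
    · exact ih (by omega) i (by omega)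
    · have hieq : i = j + 1 := by omega
      subst hieq
      have ih' := ih (by omega)
      -- the past dominates position `j + 1`: chain the one-step comparisons of the induction hypothesis
      have hchain : ∀ t, t ≤ j + 1 → d (j + 1) ≤ d (j + 1 - t) := by
        intro t
        induction t with
        | zero => intro _; simp
        | succ t iht =>
          intro ht
          have h1 := iht (by omega)
          have h2 := ih' (j - t) (by omega)
          rw [show j - t + 1 = j + 1 - t by omega] at h2
          rw [show j + 1 - (t + 1) = j - t by omega]
          exact h1.trans h2
      have hdomPast : ∀ i, i < j + 1 → d (j + 1) ≤ d i := by
        intro i hi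
        have := hchain (j + 1 - i) (by omega)
        rwa [show j + 1 - (j + 1 - i) = i by omega] at this
      have hstep := disc_step_ge_of_dominated hβ hb hρ0 hA hB hApos hBpos hpin (j := j + 1) (by omega)
        (fun i hi => by simpa [hd] using hdomPast i hi)
      have hc := hcrit (j + 1) (by omega) hjJ
      simp only [hd]
      linarith

/-- **COROLLARY: THE WHOLE RUN.**  Road P3's order-0 profile family in ]0,γ] with a profile non-increasing on the positive ages and memory `A`
(`ρ(a) = 0` for `a > A`), `Σ_{a<N} ρ(a) ≤ W`, `Wγ ≤ 2b`; two pinned runs A: `K` ∕ B: `K + n`.  IF the memory-zone criterion of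
`disc_mono_of_criterion` holds at every position `1 ≤ j < min(A, K)`, THEN `d_{j+1} ≤ d_j` at EVERY `j < K` — the memory zone by the criterion,
the positions `j ≥ A` by the echo count `…EchoMonotone.disc_succ_le_disc_of_memory_le` (unconditional).  Census (i′) for memory `A ≥ 3` is thus
REDUCED to the a-priori inequality «position excess ≤ extra source» on the `A − 1` memory-zone positions. [cite: Balaban1987RG1, (0.20) p.256, (0.31) and Thm 2 p.259] -/
theorem disc_succ_le_disc_of_criterion
    (hβ : ∀ (k : ℕ) (p : Fin (k + 1) → ℝ),
      β k p = b + ∑ i : Fin (k + 1), ρ (k - i) * min (p (Fin.last k)) (|p (Fin.last k) - p i|))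
    (hb : 0 < b) (hρ0 : ∀ a, 0 ≤ ρ a) (hρW : ∀ n, ∑ a ∈ range n, ρ a ≤ W) (hmono : ∀ a, 1 ≤ a → ρ (a + 1) ≤ ρ a)
    (hWγ : W * γ ≤ 2 * b) {A : ℕ} (hρA : ∀ a, A < a → ρ a = 0) {K n : ℕ} {gA gB : ℕ → ℝ} (hA : RGEqH K β gA)
    (hB : RGEqH (K + n) β gB) (hAbox : ∀ k, k ≤ K → 0 < gA k ∧ gA k ≤ γ) (hBpos : ∀ k, k ≤ K + n → 0 < gB k)
    (hpin : gA K = gB (K + n))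
    (hcrit : ∀ j, 1 ≤ j → j < A → j < K →
      ∑ i ∈ range j, ρ (j - i) * ((gA j - gB (j + n))
          - (gA i - 1 / Real.sqrt (1 / (gA i) ^ 2 + (1 / (gB (j + n)) ^ 2 - 1 / (gA j) ^ 2))))
        ≤ ∑ i ∈ range n, ρ (j + n - i) * (gB (j + n) - gB i)) :
    ∀ j, j < K → 1 / (gB (j + 1 + n)) ^ 2 - 1 / (gA (j + 1)) ^ 2 ≤ 1 / (gB (j + n)) ^ 2 - 1 / (gA j) ^ 2 := by
  have hApos : ∀ k, k ≤ K → 0 < gA k := fun k hk => (hAbox k hk).1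
  intro j hj
  rcases Nat.lt_or_ge j A with hjA | hjA
  · -- memory zone: the criterion up to `J = j`
    exact disc_mono_of_criterion hβ hb hρ0 hA hB hApos hBpos hpin hj
      (fun i hi1 hiJ => hcrit i hi1 (by omega) (by omega)) j le_rfl
  · exact disc_succ_le_disc_of_memory_le hβ hb hρ0 hρW hmono hWγ hρA hA hB hAbox hBpos hpin hjA hj

/-! ## §4 A tool for the criterion: the discrepancy in the memory zone with the pin's window dropped -/

/-- **THE DISCREPANCY WITH THE PIN'S WINDOW DROPPED.**  Same two pinned runs (any `ρ ≥ 0`): for every `j₀ ≤ K` and every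
`N ≥ K`,
`d_{j₀} ≤ Σ_{j∈[j₀,K)} E_j + Σ_{i<j₀} e_i·(R(K−i) − R(j₀−i)) + Σ_{i∈[j₀,K)} e_i·(R(N) − R(i+1))` — generation 49's window identity with each window
position's outgoing weight `R(K−i)` replaced by the full mass `R(N)` (so only the FUTURE-IN-MEMORY echo weights `R(N) − R(i+1) = Σ_{a>i} ρ(a)` remain,
which vanish beyond the memory).  With `echo_weight_le` the middle term is at most `(K − j₀)·Σ_{i<j₀} ρ(j₀−i)e_i` for a non-increasing profile.
[cite: Balaban1987RG1, (0.20) p.256 and Thm 2 p.259] -/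
theorem disc_le_dropped
    (hβ : ∀ (k : ℕ) (p : Fin (k + 1) → ℝ),
      β k p = b + ∑ i : Fin (k + 1), ρ (k - i) * min (p (Fin.last k)) (|p (Fin.last k) - p i|))
    (hb : 0 < b) (hρ0 : ∀ a, 0 ≤ ρ a) {K n : ℕ} {gA gB : ℕ → ℝ} (hA : RGEqH K β gA) (hB : RGEqH (K + n) β gB)
    (hApos : ∀ k, k ≤ K → 0 < gA k) (hBpos : ∀ k, k ≤ K + n → 0 < gB k) (hpin : gA K = gB (K + n)) {j₀ : ℕ} (hj₀ : j₀ ≤ K)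
    {N : ℕ} (hN : K ≤ N) :
    1 / (gB (j₀ + n)) ^ 2 - 1 / (gA j₀) ^ 2
      ≤ (∑ j ∈ Ico j₀ K, ∑ i ∈ range n, ρ (j + n - i) * (gB (j + n) - gB i))
        + (∑ i ∈ range j₀, (gA i - gB (i + n)) * (∑ a ∈ range (K - i), ρ a - ∑ a ∈ range (j₀ - i), ρ a))
        + ∑ i ∈ Ico j₀ K, (gA i - gB (i + n)) * (∑ a ∈ range N, ρ a - ∑ a ∈ range (i + 1), ρ a) := by
  rw [window_identity hβ hb hρ0 hA hB hApos hBpos hpin hj₀]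
  have hdom := invSq_le_invSq_shift_run hβ hb hρ0 hA hB hApos hBpos hpin
  have h3 : ∑ i ∈ Ico j₀ K, (gA i - gB (i + n)) * (∑ a ∈ range (K - i), ρ a - ∑ a ∈ range (i + 1), ρ a)
      ≤ ∑ i ∈ Ico j₀ K, (gA i - gB (i + n)) * (∑ a ∈ range N, ρ a - ∑ a ∈ range (i + 1), ρ a) := by
    refine Finset.sum_le_sum fun i hi => ?_
    have hi' := Finset.mem_Ico.mp hi
    have he : 0 ≤ gA i - gB (i + n) := by
      linarith [le_of_one_div_sq_le (hApos i hi'.2.le) (hBpos (i + n) (by omega)) (hdom i hi'.2.le)]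
    have hR : ∑ a ∈ range (K - i), ρ a ≤ ∑ a ∈ range N, ρ a := partialSum_mono hρ0 (by omega)
    exact mul_le_mul_of_nonneg_left (by linarith) he
  linarith

/-- … AND WITH THE ECHO COUNT: for a profile non-increasing on the positive ages,
`d_{j₀} ≤ Σ_{j∈[j₀,K)} E_j + (K − j₀)·Σ_{i<j₀} ρ(j₀−i)e_i + Σ_{i∈[j₀,K)} e_i·(R(N) − R(i+1))`. [cite: Balaban1987RG1, (0.20) p.256 and Thm 2 p.259] -/
theorem disc_le_dropped_echo
    (hβ : ∀ (k : ℕ) (p : Fin (k + 1) → ℝ),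
      β k p = b + ∑ i : Fin (k + 1), ρ (k - i) * min (p (Fin.last k)) (|p (Fin.last k) - p i|))
    (hb : 0 < b) (hρ0 : ∀ a, 0 ≤ ρ a) (hmono : ∀ a, 1 ≤ a → ρ (a + 1) ≤ ρ a) {K n : ℕ} {gA gB : ℕ → ℝ} (hA : RGEqH K β gA)
    (hB : RGEqH (K + n) β gB) (hApos : ∀ k, k ≤ K → 0 < gA k) (hBpos : ∀ k, k ≤ K + n → 0 < gB k) (hpin : gA K = gB (K + n))
    {j₀ : ℕ} (hj₀ : j₀ ≤ K) {N : ℕ} (hN : K ≤ N) :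
    1 / (gB (j₀ + n)) ^ 2 - 1 / (gA j₀) ^ 2
      ≤ (∑ j ∈ Ico j₀ K, ∑ i ∈ range n, ρ (j + n - i) * (gB (j + n) - gB i))
        + ((K - j₀ : ℕ) : ℝ) * ∑ i ∈ range j₀, ρ (j₀ - i) * (gA i - gB (i + n))
        + ∑ i ∈ Ico j₀ K, (gA i - gB (i + n)) * (∑ a ∈ range N, ρ a - ∑ a ∈ range (i + 1), ρ a) := by
  have hdom := invSq_le_invSq_shift_run hβ hb hρ0 hA hB hApos hBpos hpin
  refine (disc_le_dropped hβ hb hρ0 hA hB hApos hBpos hpin hj₀ hN).trans ?_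
  have h2 : ∑ i ∈ range j₀, (gA i - gB (i + n)) * (∑ a ∈ range (K - i), ρ a - ∑ a ∈ range (j₀ - i), ρ a)
      ≤ ((K - j₀ : ℕ) : ℝ) * ∑ i ∈ range j₀, ρ (j₀ - i) * (gA i - gB (i + n)) := by
    rw [Finset.mul_sum]
    refine Finset.sum_le_sum fun i hi => ?_
    have hi' := Finset.mem_range.mp hi
    have he : 0 ≤ gA i - gB (i + n) := by
      linarith [le_of_one_div_sq_le (hApos i (by omega)) (hBpos (i + n) (by omega)) (hdom i (by omega))]
    have hw := echo_weight_le hmono hi' hj₀ (K := K)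
    calc (gA i - gB (i + n)) * (∑ a ∈ range (K - i), ρ a - ∑ a ∈ range (j₀ - i), ρ a)
        ≤ (gA i - gB (i + n)) * (((K - j₀ : ℕ) : ℝ) * ρ (j₀ - i)) := mul_le_mul_of_nonneg_left hw he
      _ = ((K - j₀ : ℕ) : ℝ) * (ρ (j₀ - i) * (gA i - gB (i + n))) := by ring
  linarith

end Summit.QuantumFields.BalabanUV.Beta.RemainderExplicitHistoryDiagonalMemoryZone
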